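import Summits.QuantumFields.BalabanUV.Beta.FP.PerfectFFBlockBounded
import Summits.QuantumFields.BalabanUV.Beta.FP.KernelPeriodisationFib
import Summits.QuantumFields.BalabanUV.Beta.GAN24.TorusJunction

/-!
# `BalabanUV.Beta.FP.PackedResolventTorusCorners` — road «FP» (binder row D1), ROUTE T (owner ruling R-FP-51, journal
# 2026-08-21T20:37:25Z [D1P3-G16-RFP51]), row **(T-ID) «corner junctions»** — THE FOUR BLOCKS OF THE FINE-PERIOD
# PERIODISATION OF an2's PACKED ONE-STEP RESOLVENT `KInv N = [[Γ, ℋ],[ℋ♭, −𝒞]]`, READ ON EVERY TORUS OFF b05's MATRICES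
# `𝒞` (1.107), `H_k` (1.103), `Δ_k` (1.65), WITH THE COARSE-SUBLATTICE TESTS AND BLOCK INDICES DISPLAYED:
# `Σ_{t∈ℤ^{d+1}} KInv N x (y + (NM)•t) a b =`
#   ff `(N²∕2)·Re 𝒞((x̄, κ), (ȳ, l))` · fm `[N ∣ y]·N^{−(d+2)}·Re H_k((x̄, κ), (y∕N mod M, l))` ·
#   mf `−[N ∣ x]·N^{−(d+2)}·Re H_k((ȳ, l), (x∕N mod M, κ))` · mm `[N ∣ x][N ∣ y]·2N^{−(d+5)}·Re Δ_k((x∕N mod M, κ), (y∕N mod M, l))`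

NOT IN PRINT; OUR BOOKKEEPING.  HONEST FRAMING (cell contract, verbatim): «discharging `BetaPertH` makes Bałaban's UV stability
UNCONDITIONAL — a real constructive-QFT result; it is NOT the continuum limit and NOT the Clay problem.»  HONEST DEPENDENCY (verbatim):
«continuum YM on T⁴ ⇐ BetaPertH ∧ nine spine estimates (0/9 proved); BetaPertH ⇐ (D1) ∧ (D4) ∧ CAP+tail; G-an2-4 gates asym, D1 and
NE2/3/4.»  THIS MODULE proves NO estimate, instantiates NO wall binder, defines nothing, cites nothing as a hypothesis; it PACKAGES,
block by block and BY NAME, the four torus junctions that are already in the tree — ff `CompositeCovarianceJunction.tsum_Gam_pshift_eq_Cov`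
(integer-point form `PerfectFFBlockBounded.tsum_Gam_pshift_eq_re_Cov`), fm `CompositeMinimiserJunction.tsum_wH_pshift_eq_Hk`, mm
`GAN24/TorusJunction.Φper_eq_DelK`, mf by an5's antisymmetry `ResolventComposition.GamΦ_eq_neg_wH` (`ℋ♭ = −ℋᵀ`) — as statements
about the PACKED kernel `OneStepResolventKernel.KInv` itself (coarse legs carried on `N•ℤ^{d+1}`, zero off it), periodised in its
SECOND argument over the fine period lattice `pshift (fine N M) ℤ^{d+1}`.  That periodisation is, term for term, gan24-p3's (T-PER)
adapter `KernelPeriodisationFib.perZ (fine N M) (KInv N) x y a b` (`perZ_apply`, `translate M y m = y + pshift M m`; §4 restates the four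
corners in that currency), so route T's torus words of the road's resolvents (gan24-p3's `perZ_dec_KInv` ∕ `perZ_KInvStep` reduce every
(j, m) object to `dec ∘ perZ`) read off b05's matrices through these four displayed entries.  0 sorry.  NOT (T-ID) itself (the torus INSTANCE's use of these entries is row
(T-INST-j)), NOT (T-INV), NOT SDF, NOT D1, NOT BetaPertH, NOT continuum, NOT Clay.

ABSOLUTE RULE (cell charter, verbatim): «No internally-minted statement may enter as a cited fact. Every hypothesis is either
kernel-proved in this package or a verbatim quotation of a PUBLISHED theorem with page reference. The manuscript(s) under audit are NOT
citable for their own disputed steps — they are the thing under adjudication; programme-internal (2001/route/tribunal) claims are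
never citable.»

CONTENT (every `d`, every blocking `N ≥ 1`, every torus `M : Fin (d+1) → ℕ` with `M_ν ≥ 1`; b05's dummy parameter fixed at `a := 1`
as in `PerfectFFBlockBounded` — `𝒞`, `H_k`, `Δ_k` do not depend on it, `FluctuationProjection.Cov_indep` ∕ `Hk_indep` ∕
`BlockEffectiveAction.DelK_indep`).
* §1 [folklore] bookkeeping: `proj_add_pshift_fine` (the sublattice test `Torus.proj N` is blind to fine-period shifts),
  `quo_add_pshift_fine` (the block index moves by the coarse period shift), `exists_eq_add_pshift_of_toTor_eq`,
  `summable_KInv_pshift` (every block's period sum converges absolutely, `OneStepResolventKernel.decays_KInv`).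
* §2 integer-point junctions for the off-diagonal and coarse kernels: **`tsum_wH_pshift_eq_re_Hk`**
  (`Σ_t wH κ l ((x − N•q) + (NM)•t) = N^{−(d+2)}·Re H_k((x̄, κ), (q̄, l))` for EVERY coarse site `q ∈ ℤ^{d+1}`, not only canonical
  lifts) and the two-point mm form **`tsum_wΦ_pshift_eq_re_DelK₂`** (`Σ_t wΦ κ l ((q − q′) + M•t) = 2N^{−(d+5)}·Re Δ_k((q̄, κ), (q̄′, l))`).
* §3 THE FOUR CORNERS of `Σ_t KInv N x (y + pshift (fine N M) t) a b`: **`tsum_KInv_pshift_inl_inl`**, **`tsum_KInv_pshift_inl_inr`**,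
  **`tsum_KInv_pshift_inr_inl`**, **`tsum_KInv_pshift_inr_inr`** (displayed above).
* §4 THE SAME IN gan24-p3's (T-PER) CURRENCY (`FP/KernelPeriodisationFib`, p304628): `perZ_fine_apply` (`perZ (fine N M) K x y a b` IS the
  period sum of §3, `perZ_apply` + `translate_eq_add`, definitional) and **`perZ_KInv_inl_inl`** ∕ **`perZ_KInv_inl_inr`** ∕ **`perZ_KInv_inr_inl`** ∕
  **`perZ_KInv_inr_inr`** — the four entries of `perZ (fine N M) (KInv N)`, hence of the torus matrix `perF (fine N M) (KInv N)` (`perF_apply`).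
Orientation only (nothing used as a hypothesis): [Balaban1984PropagatorsI] = T. Bałaban, Commun. Math. Phys. 95 (1984) 17–40,
(1.65) p. 29, (1.103) p. 34, (1.107) p. 35.
Provenance: G-an2-4 formalisation swarm, unit `b2b-balaban-gan24-formalise-leaf-05` gen 47, 2026-08-21; road-FP owner ruling
R-FP-51 row (T-ID) («first refusal leaf-05 ∕ gan24-leaf-05»).
-/

noncomputable section

open scoped BigOperators

namespace Summit.QuantumFields.BalabanUV.Beta.FP.PackedResolventTorusCorners

open Literature.Probability.LatticeModels (Torus.proj)
open Literature.MathematicalPhysics.QuantumFieldTheory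
open Literature.MathematicalPhysics.QuantumFieldTheory.Balaban1983to89
open Literature.MathematicalPhysics.QuantumFieldTheory.Balaban1983to89.Beta
open AffineAveraging (Site)
open LatticeForm (quo proj_add_zsmul)
open BlochFibreUniqueness (quo_add_zsmul)
open B12Sec2to5 (l1)
open ExpKernelCalculus (l1_sub_symm)
open B5Prop11Plancherel (Tor fine)
open FluctuationProjection (Cov Hk)
open BlockEffectiveAction (DelK)
open KernelSpecInstance (wH wΦ)
open KKTFluctuationKernel (Gam GamΦ)
open OneStepResolventKernel (Fib KInv KInv_inl_inl KInv_inl_inr_off KInv_inr_off eq_zsmul_quo_of_proj decays_KInv)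
open ResolventComposition (GamΦ_eq_neg_wH)
open Summit.QuantumFields.BalabanUV.Beta.GAN24.TorusAvatar (toTor liftT toTor_liftT toTor_sub)
open Summit.QuantumFields.BalabanUV.Beta.GAN24.TorusPeriodise (pshift pshift_add pshift_fine summable_pshift tsum_shift_index Φper
  HΦcol_sub_pshift Φper_congr)
open Summit.QuantumFields.BalabanUV.Beta.GAN24.TorusJunction (Φper_eq_DelK)
open Summit.QuantumFields.BalabanUV.Beta.FP.CompositeMinimiserJunction (tsum_wH_pshift_eq_Hk)
open Summit.QuantumFields.BalabanUV.Beta.FP.PerfectFFBlockBounded (tsum_Gam_pshift_eq_re_Cov)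
open Summit.QuantumFields.BalabanUV.Beta.FP.KernelPeriodisationFib (perZ perZ_apply translate_eq_add)

/-! ## §1 Bookkeeping: sublattice test, block index and summability under fine-period shifts -/

section Bookkeeping

variable {d : ℕ} (N : ℕ) [NeZero N] (M : Fin (d + 1) → ℕ)

omit [NeZero N] in
/-- [folklore] The coarse-sublattice test `Torus.proj N` is blind to a shift by the fine period lattice `(N·M)•ℤ^{d+1}`. -/
theorem proj_add_pshift_fine (y t : Site (d + 1)) : Torus.proj N (y + pshift (fine N M) t) = Torus.proj N y := by
  rw [pshift_fine, proj_add_zsmul]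

/-- [folklore] The block index of a fine-period translate is the coarse-period translate of the block index. -/
theorem quo_add_pshift_fine (y t : Site (d + 1)) : quo N (y + pshift (fine N M) t) = quo N y + pshift M t := by
  rw [pshift_fine, quo_add_zsmul]

omit [NeZero N] in
/-- [folklore] Two lattice points with the same residue mod `P` differ by a period vector. -/
theorem exists_eq_add_pshift_of_toTor_eq {D : ℕ} (P : Fin D → ℕ) {x y : Site D} (h : toTor P x = toTor P y) :
    ∃ k : Site D, y = x + pshift P k := by
  have hd : ∀ ν, ((P ν : ℕ) : ℤ) ∣ y ν - x ν := by
    intro ν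
    have hν := congr_fun h ν
    simp only [toTor] at hν
    exact (ZMod.intCast_eq_intCast_iff_dvd_sub _ _ _).1 hν
  choose k hk using hd
  refine ⟨k, funext fun ν => ?_⟩
  simp only [Pi.add_apply, pshift]
  have := hk ν
  linarith

/-- [folklore] Every block of the packed resolvent has an absolutely convergent period sum along the fine period lattice
(exponential decay `OneStepResolventKernel.decays_KInv`; `GAN24/TorusPeriodise.summable_pshift`). -/
theorem summable_KInv_pshift [∀ ν, NeZero (M ν)] (x y : Site (d + 1)) (a b : Fib d) :
    Summable fun t : Site (d + 1) => KInv (N := N) x (y + pshift (fine N M) t) a b := by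
  obtain ⟨δ, C, hδ, _, hdec⟩ := decays_KInv (N := N) (d := d)
  have hf : ∀ z : Site (d + 1), |KInv (N := N) x (x + z) a b| ≤ C * Real.exp (-δ * l1 z) := by
    intro z
    have h := hdec x (x + z) a b
    rwa [l1_sub_symm, add_sub_cancel_left] at h
  have hs := summable_pshift hδ hf (fine N M) (y - x)
  refine hs.congr fun t => ?_
  congr 1
  abel

end Bookkeeping

/-! ## §2 Integer-point junctions for `wH` (every coarse site) and the two-point form for `wΦ` -/

section IntegerPoints

variable {d : ℕ} (N : ℕ) [NeZero N] (hN : 1 ≤ N) (M : Fin (d + 1) → ℕ) [hM : ∀ ν, NeZero (M ν)]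

/-- [our object] **THE fm JUNCTION AT EVERY COARSE SITE**: for all `x, q ∈ ℤ^{d+1}`,
`Σ_t wH κ l ((x − N•q) + (NM)•t) = N^{−(d+2)} · Re H_k((x mod NM, κ), (q mod M, l))` — leaf-05 g15's `tsum_wH_pshift_eq_Hk` (stated at
the canonical lift `liftT (toTor M q)`) moved to `q` by re-indexing the period sum; `H_k` is real (`CompositeMinimiserJunction.Hk_apply_im`). -/
theorem tsum_wH_pshift_eq_re_Hk (κ l : Fin (d + 1)) (x q : Site (d + 1)) :
    ∑' t : Site (d + 1), wH (N := N) κ l ((x - (N : ℤ) • q) + pshift (fine N M) t)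
      = ((N : ℝ) ^ (d + 2))⁻¹ * (Hk N hN M 1 one_pos (toTor (fine N M) x, κ) (toTor M q, l)).re := by
  obtain ⟨k, hk⟩ := exists_eq_add_pshift_of_toTor_eq M (x := q) (y := liftT (toTor M q)) (by rw [toTor_liftT])
  have h := tsum_wH_pshift_eq_Hk N hN M 1 one_pos κ l (toTor M q) x
  have e : ∑' t : Site (d + 1), wH (N := N) κ l (x - (N : ℤ) • liftT (toTor M q) + pshift (fine N M) t)
      = ∑' t : Site (d + 1), wH (N := N) κ l ((x - (N : ℤ) • q) + pshift (fine N M) t) := by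
    have key : ∀ t : Site (d + 1), x - (N : ℤ) • liftT (toTor M q) + pshift (fine N M) t
        = (x - (N : ℤ) • q) + pshift (fine N M) (t + (-k)) := by
      intro t
      rw [hk, smul_add, ← pshift_fine, pshift_add,
        show pshift (fine N M) (-k) = -pshift (fine N M) k by funext ν; simp [pshift]]
      abel
    simp_rw [key]
    exact tsum_shift_index (fun t => wH (N := N) κ l ((x - (N : ℤ) • q) + pshift (fine N M) t)) (-k)
  rw [← e]
  have h' := congrArg Complex.re h
  rw [Complex.ofReal_re] at h'
  rw [h', show ((N : ℂ) ^ (d + 2))⁻¹ = (((((N : ℝ) ^ (d + 2))⁻¹ : ℝ)) : ℂ) by push_cast; rfl, Complex.re_ofReal_mul]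

/-- [our object] **THE mm JUNCTION, TWO-POINT FORM**: for all coarse sites `q, q′ ∈ ℤ^{d+1}`,
`Σ_t wΦ κ l ((q − q′) + M•t) = 2·N^{−(d+5)} · Re Δ_k((q mod M, κ), (q′ mod M, l))` — gan24-leaf-18's `Φper_eq_DelK` (bond form) unfolded
through `Φper_congr`; `Δ_k` is b05's (1.65) block effective action (`BlockEffectiveAction.DelK`). -/
theorem tsum_wΦ_pshift_eq_re_DelK₂ (κ l : Fin (d + 1)) (q q' : Site (d + 1)) :
    ∑' t : Site (d + 1), wΦ (N := N) κ l ((q - q') + pshift M t)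
      = 2 * ((N : ℝ) ^ (d + 5))⁻¹ * (DelK N hN M 1 one_pos (toTor M q, κ) (toTor M q', l)).re := by
  have h := Φper_eq_DelK N hN M 1 one_pos (toTor M q, κ) (toTor M q', l)
  have hΦ : Φper N M l (liftT (toTor M q')) κ (liftT (toTor M q)) = ∑' t : Site (d + 1), wΦ (N := N) κ l ((q - q') + pshift M t) := by
    rw [Φper_congr N M l (q' := q') (y' := q) (by rw [toTor_sub, toTor_sub, toTor_liftT, toTor_liftT])]
    simp only [Φper, HΦcol_sub_pshift]
  rw [← hΦ]
  have h' := congrArg Complex.re h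
  rw [Complex.ofReal_re] at h'
  rw [h', show (2 : ℂ) * ((N : ℂ) ^ (d + 5))⁻¹ = ((((2 : ℝ) * ((N : ℝ) ^ (d + 5))⁻¹ : ℝ)) : ℂ) by push_cast; rfl,
    Complex.re_ofReal_mul]

end IntegerPoints

/-! ## §3 The four corners of the periodised packed resolvent -/

section Corners

variable {d : ℕ} (N : ℕ) [NeZero N] (hN : 1 ≤ N) (M : Fin (d + 1) → ℕ) [hM : ∀ ν, NeZero (M ν)]

/-- [our object] **ff CORNER**: `Σ_t KInv N x (y + (NM)•t) (inl κ) (inl l) = (N²∕2)·Re 𝒞((x mod NM, κ), (y mod NM, l))` — the block is an2's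
fluctuation covariance `Γ` (`KInv_inl_inl`) and the junction is leaf-05's `PerfectFFBlockBounded.tsum_Gam_pshift_eq_re_Cov` verbatim. -/
theorem tsum_KInv_pshift_inl_inl (κ l : Fin (d + 1)) (x y : Site (d + 1)) :
    ∑' t : Site (d + 1), KInv (N := N) x (y + pshift (fine N M) t) (Sum.inl κ) (Sum.inl l)
      = ((N : ℝ) ^ 2 / 2) * (Cov N hN M 1 one_pos (toTor (fine N M) x, κ) (toTor (fine N M) y, l)).re := by
  simp only [KInv_inl_inl]
  exact tsum_Gam_pshift_eq_re_Cov N hN M κ l x y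

/-- [our object] **fm CORNER**: `Σ_t KInv N x (y + (NM)•t) (inl κ) (inr l) = [N ∣ y]·N^{−(d+2)}·Re H_k((x mod NM, κ), (y∕N mod M, l))` — on the coarse
sublattice (`Torus.proj N y = 0`, a test blind to the shifts, §1) the block is an2's minimiser kernel `wH κ l (x − y − (NM)•t)`, `y = N•quo N y`
(`eq_zsmul_quo_of_proj`), and the period sum (re-indexed `t ↦ −t`) is §2's `tsum_wH_pshift_eq_re_Hk`; off it every term vanishes (`KInv_inl_inr_off`). -/
theorem tsum_KInv_pshift_inl_inr (κ l : Fin (d + 1)) (x y : Site (d + 1)) :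
    ∑' t : Site (d + 1), KInv (N := N) x (y + pshift (fine N M) t) (Sum.inl κ) (Sum.inr l)
      = if Torus.proj N y = 0 then
          ((N : ℝ) ^ (d + 2))⁻¹ * (Hk N hN M 1 one_pos (toTor (fine N M) x, κ) (toTor M (quo N y), l)).re
        else 0 := by
  by_cases hy : Torus.proj N y = 0
  · rw [if_pos hy]
    have key : ∀ t : Site (d + 1), KInv (N := N) x (y + pshift (fine N M) t) (Sum.inl κ) (Sum.inr l)
        = wH (N := N) κ l ((x - (N : ℤ) • quo N y) + pshift (fine N M) (-t)) := by
      intro t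
      have hyt : Torus.proj N (y + pshift (fine N M) t) = 0 := by rw [proj_add_pshift_fine, hy]
      simp only [KInv, hyt, if_true]
      rw [show pshift (fine N M) (-t) = -pshift (fine N M) t by funext ν; simp [pshift]]
      conv_lhs => rw [eq_zsmul_quo_of_proj (N := N) hy]
      congr 1
      abel
    simp_rw [key]
    rw [← tsum_wH_pshift_eq_re_Hk N hN M κ l x (quo N y)]
    exact (Equiv.neg (Site (d + 1))).tsum_eq (fun s => wH (N := N) κ l ((x - (N : ℤ) • quo N y) + pshift (fine N M) s))
  · rw [if_neg hy]
    have key : ∀ t : Site (d + 1), KInv (N := N) x (y + pshift (fine N M) t) (Sum.inl κ) (Sum.inr l) = 0 := by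
      intro t
      have hyt : Torus.proj N (y + pshift (fine N M) t) ≠ 0 := by rwa [proj_add_pshift_fine]
      exact KInv_inl_inr_off (N := N) hyt κ l x
    simp_rw [key]
    exact tsum_zero

/-- [our object] **mf CORNER**: `Σ_t KInv N x (y + (NM)•t) (inr κ) (inl l) = −[N ∣ x]·N^{−(d+2)}·Re H_k((y mod NM, l), (x∕N mod M, κ))` — on the coarse
sublattice the block is `GamΦ κ (quo N x) l (·)` = `−wH l κ (· − N•quo N x)` (an5's `ResolventComposition.GamΦ_eq_neg_wH`, `ℋ♭ = −ℋᵀ`), then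
§2's `tsum_wH_pshift_eq_re_Hk` with the legs exchanged; off it every term vanishes (`KInv_inr_off`). -/
theorem tsum_KInv_pshift_inr_inl (κ l : Fin (d + 1)) (x y : Site (d + 1)) :
    ∑' t : Site (d + 1), KInv (N := N) x (y + pshift (fine N M) t) (Sum.inr κ) (Sum.inl l)
      = if Torus.proj N x = 0 then
          -(((N : ℝ) ^ (d + 2))⁻¹ * (Hk N hN M 1 one_pos (toTor (fine N M) y, l) (toTor M (quo N x), κ)).re)
        else 0 := by
  by_cases hx : Torus.proj N x = 0
  · rw [if_pos hx]
    have key : ∀ t : Site (d + 1), KInv (N := N) x (y + pshift (fine N M) t) (Sum.inr κ) (Sum.inl l)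
        = -wH (N := N) l κ ((y - (N : ℤ) • quo N x) + pshift (fine N M) t) := by
      intro t
      simp only [KInv, hx, if_true]
      rw [GamΦ_eq_neg_wH]
      congr 2
      abel
    simp_rw [key]
    rw [tsum_neg, tsum_wH_pshift_eq_re_Hk N hN M l κ y (quo N x)]
  · rw [if_neg hx]
    have key : ∀ t : Site (d + 1), KInv (N := N) x (y + pshift (fine N M) t) (Sum.inr κ) (Sum.inl l) = 0 :=
      fun t => KInv_inr_off (N := N) hx κ _ _
    simp_rw [key]
    exact tsum_zero

/-- [our object] **mm CORNER**: `Σ_t KInv N x (y + (NM)•t) (inr κ) (inr l) = [N ∣ x][N ∣ y]·2N^{−(d+5)}·Re Δ_k((x∕N mod M, κ), (y∕N mod M, l))` — on the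
coarse sublattice in both legs the block is an2's multiplier response `wΦ κ l (quo N x − quo N y − M•t)` (the block index of the shifted leg moves by
`pshift M t`, §1), and the period sum (re-indexed `t ↦ −t`) is §2's `tsum_wΦ_pshift_eq_re_DelK₂`; otherwise every term vanishes. -/
theorem tsum_KInv_pshift_inr_inr (κ l : Fin (d + 1)) (x y : Site (d + 1)) :
    ∑' t : Site (d + 1), KInv (N := N) x (y + pshift (fine N M) t) (Sum.inr κ) (Sum.inr l)
      = if Torus.proj N x = 0 ∧ Torus.proj N y = 0 then
          2 * ((N : ℝ) ^ (d + 5))⁻¹ * (DelK N hN M 1 one_pos (toTor M (quo N x), κ) (toTor M (quo N y), l)).re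
        else 0 := by
  by_cases hx : Torus.proj N x = 0
  · by_cases hy : Torus.proj N y = 0
    · rw [if_pos ⟨hx, hy⟩]
      have key : ∀ t : Site (d + 1), KInv (N := N) x (y + pshift (fine N M) t) (Sum.inr κ) (Sum.inr l)
          = wΦ (N := N) κ l ((quo N x - quo N y) + pshift M (-t)) := by
        intro t
        have hyt : Torus.proj N (y + pshift (fine N M) t) = 0 := by rw [proj_add_pshift_fine, hy]
        simp only [KInv, hx, hyt, and_self, if_true]
        rw [quo_add_pshift_fine, show pshift M (-t) = -pshift M t by funext ν; simp [pshift]]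
        congr 1
        abel
      simp_rw [key]
      rw [← tsum_wΦ_pshift_eq_re_DelK₂ N hN M κ l (quo N x) (quo N y)]
      exact (Equiv.neg (Site (d + 1))).tsum_eq (fun s => wΦ (N := N) κ l ((quo N x - quo N y) + pshift M s))
    · rw [if_neg (fun h => hy h.2)]
      have key : ∀ t : Site (d + 1), KInv (N := N) x (y + pshift (fine N M) t) (Sum.inr κ) (Sum.inr l) = 0 := by
        intro t
        have hyt : ¬ Torus.proj N (y + pshift (fine N M) t) = 0 := by rwa [proj_add_pshift_fine]
        simp only [KInv, hyt, and_false, if_false]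
      simp_rw [key]
      exact tsum_zero
  · rw [if_neg (fun h => hx h.1)]
    have key : ∀ t : Site (d + 1), KInv (N := N) x (y + pshift (fine N M) t) (Sum.inr κ) (Sum.inr l) = 0 :=
      fun t => KInv_inr_off (N := N) hx κ _ _
    simp_rw [key]
    exact tsum_zero

end Corners

/-! ## §4 The four corners in the (T-PER) adapter's currency `perZ (fine N M) (KInv N)` -/

section PerZ

variable {d : ℕ} (N : ℕ) [NeZero N] (hN : 1 ≤ N) (M : Fin (d + 1) → ℕ) [hM : ∀ ν, NeZero (M ν)]

omit [NeZero N] hM in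
/-- [folklore] gan24-p3's periodised kernel along the fine period lattice IS the period sum of §3, entry by entry (`perZ_apply` +
`translate_eq_add`; `translate (fine N M) y t = y + pshift (fine N M) t` definitionally). -/
theorem perZ_fine_apply {F : Type*} (K : ExpKernelCalculus.MKer (d + 1) F) (x y : Site (d + 1)) (a b : F) :
    perZ (fine N M) K x y a b = ∑' t : Site (d + 1), K x (y + pshift (fine N M) t) a b := by
  simp only [perZ_apply, translate_eq_add]
  rfl

/-- [our object] **ff ENTRY of `perZ (fine N M) (KInv N)`** = `(N²∕2)·Re 𝒞((x mod NM, κ), (y mod NM, l))`. -/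
theorem perZ_KInv_inl_inl (κ l : Fin (d + 1)) (x y : Site (d + 1)) :
    perZ (fine N M) (KInv (N := N)) x y (Sum.inl κ) (Sum.inl l)
      = ((N : ℝ) ^ 2 / 2) * (Cov N hN M 1 one_pos (toTor (fine N M) x, κ) (toTor (fine N M) y, l)).re := by
  rw [perZ_fine_apply, tsum_KInv_pshift_inl_inl N hN M]

/-- [our object] **fm ENTRY of `perZ (fine N M) (KInv N)`** = `[N ∣ y]·N^{−(d+2)}·Re H_k((x mod NM, κ), (y∕N mod M, l))`. -/
theorem perZ_KInv_inl_inr (κ l : Fin (d + 1)) (x y : Site (d + 1)) :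
    perZ (fine N M) (KInv (N := N)) x y (Sum.inl κ) (Sum.inr l)
      = if Torus.proj N y = 0 then
          ((N : ℝ) ^ (d + 2))⁻¹ * (Hk N hN M 1 one_pos (toTor (fine N M) x, κ) (toTor M (quo N y), l)).re
        else 0 := by
  rw [perZ_fine_apply, tsum_KInv_pshift_inl_inr N hN M]

/-- [our object] **mf ENTRY of `perZ (fine N M) (KInv N)`** = `−[N ∣ x]·N^{−(d+2)}·Re H_k((y mod NM, l), (x∕N mod M, κ))`. -/
theorem perZ_KInv_inr_inl (κ l : Fin (d + 1)) (x y : Site (d + 1)) :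
    perZ (fine N M) (KInv (N := N)) x y (Sum.inr κ) (Sum.inl l)
      = if Torus.proj N x = 0 then
          -(((N : ℝ) ^ (d + 2))⁻¹ * (Hk N hN M 1 one_pos (toTor (fine N M) y, l) (toTor M (quo N x), κ)).re)
        else 0 := by
  rw [perZ_fine_apply, tsum_KInv_pshift_inr_inl N hN M]

/-- [our object] **mm ENTRY of `perZ (fine N M) (KInv N)`** = `[N ∣ x][N ∣ y]·2N^{−(d+5)}·Re Δ_k((x∕N mod M, κ), (y∕N mod M, l))`. -/
theorem perZ_KInv_inr_inr (κ l : Fin (d + 1)) (x y : Site (d + 1)) :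
    perZ (fine N M) (KInv (N := N)) x y (Sum.inr κ) (Sum.inr l)
      = if Torus.proj N x = 0 ∧ Torus.proj N y = 0 then
          2 * ((N : ℝ) ^ (d + 5))⁻¹ * (DelK N hN M 1 one_pos (toTor M (quo N x), κ) (toTor M (quo N y), l)).re
        else 0 := by
  rw [perZ_fine_apply, tsum_KInv_pshift_inr_inr N hN M]

end PerZ

end Summit.QuantumFields.BalabanUV.Beta.FP.PackedResolventTorusCorners

end
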